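import Summits.RiemannHypothesis.RiemannHypothesis.Theorems.Splittings.ScrewBridgeRigidityBordered
import HarnessLib

/-!
# Splittings — SCREW BRIDGE RIGIDITY: rigidity of degeneracy under a frozen negative index
# (`FOZ ⟹ eventually nonsingular ∨ a rigid null combination`; R2 = the null-combination residual NNC; zero-def raw form)

Cell rh-split (brief sha16 f79c5f09d8bcb036), seat rh-split-screw-bridge g4, gen-4 addendum §9 of
`run/shared/lean/pub/rh-split/cards/SPLIT-screw-bridge.md` (§6 of the seat's scratch); source bytes
`HOME/rh-split-screw-bridge/ScrewBridgeG4R.lean` sha16 3175454434f3e601 (16 theorems, zero defs; companion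
`ScrewBridgeG4.lean` §1–§5 = tree `Splittings/ScrewBridgeWeakTail.lean`).  Referee rh-split-ref g2 replay + bytes
PASS 2026-08-27T01:43:06Z («F2 3175454434f3e601 → ScrewBridgeRigidity.lean»); filed by rh-split-typer-2 g3 on the lead's
booking 01:43:05Z as part 2/2 of a TWO-FILE split forced by the 400-line rule (part 1 = `Splittings/ScrewBridgeRigidityBordered.lean`, the
bordered-matrix kernel lemma; this docblock and the namespace `…Splittings.ScrewBridgeRigidity` are the only edits; every
declaration byte-identical).  Content: the KEY LEMMA `border_dotProduct_eq_zero_of_negIndex_le` (a real symmetric bordered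
matrix whose negative index does not exceed that of its leading block has its border column orthogonal to the kernel of the
block; proof by a `(k+1)`-frame and `SylvesterInertiaCertificate`), whence `rigid_rows` and
`foz_nonsingular_or_rigidNull : FOZ → (∃ N, ∀ n ≥ N, screwDet n ≠ 0) ∨ (∃ n z ≠ 0, ∀ i : ℕ, Σ_j G_g(log(i+2), log(j+2)) z_j = 0)`;
so the residual R2 («FOZ ⟹ eventually nonsingular») is EXACTLY «FOZ ⟹ NNC», NNC = «no non-zero finite real combination of
kernel sections vanishes at every node» (`fozNonsingular_of_nnc`, `nnc_of_nonsingular_frequently`, `nnc_of_rh`,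
`foz_nonsingular_eventually_iff_frequently`, `inertiaOfFoz_iff_foz_imp_nnc`, `etail_iff_foz_of_indexTransfer_nnc`).
Everything here is RH-free linear algebra GIVEN the stated hypotheses.

HONEST LABEL: SPLITTING SEARCH over kernel-typed RH-EQUIVALENCES; a splitting A ∧ B ⟹ RH is CONDITIONAL
bookkeeping unless A and B are both proved; nothing here bears on the truth of RH.
-/

set_option linter.dupNamespace false

noncomputable section

namespace Summit.RiemannHypothesis.RiemannHypothesis.Theorems.Splittings.ScrewBridgeRigidity

open Finset Matrix
open Literature.Analysis.Matrix Literature.Analysis.Matrix.KyFan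
open Literature.Analysis.Matrix.EigenvalueCountOnSubspaces Literature.Analysis.Matrix.EigenvalueCount
open Literature.NumberTheory.LFunctions
open Summit.RiemannHypothesis.RiemannHypothesis.Theses.RuelleBand
open Summit.RiemannHypothesis.RiemannHypothesis.Theorems.IntegerScrew
open Summit.RiemannHypothesis.RiemannHypothesis.Theorems.IntegerScrew.FozIndexBound
open Summit.RiemannHypothesis.RiemannHypothesis.Theorems.Splittings.BombieriFozNoDep
open Summit.RiemannHypothesis.RiemannHypothesis.Theorems.Splittings.ScrewBridgeRaw
open Summit.RiemannHypothesis.RiemannHypothesis.Theorems.Splittings.ScrewBridgeRawG3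
open Summit.RiemannHypothesis.RiemannHypothesis.Theorems.Splittings.ScrewBridgeFozConsequences

/-! ## §6 Rigidity of degeneracy under a frozen negative index -/

section Rigidity

/-- **Screw matrices: a frozen negative index makes null vectors persist one level up.** [folklore] -/
theorem screw_snoc_mem_ker_of_negIndex_eq (n : ℕ)
    (hidx : (univ.filter fun i => (screwMatrix_isHermitian (n + 1)).eigenvalues i < 0).card =
      (univ.filter fun i => (screwMatrix_isHermitian n).eigenvalues i < 0).card)
    {z : Fin n → ℝ} (hz : screwMatrix n *ᵥ z = 0) : screwMatrix (n + 1) *ᵥ Fin.snoc z 0 = 0 := by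
  have hAB : (screwMatrix (n + 1)).submatrix Fin.castSucc Fin.castSucc = screwMatrix n := by
    ext i j; simp [screwMatrix_apply]
  have hb := border_dotProduct_eq_zero_of_negIndex_le (screwMatrix_isHermitian (n + 1))
    (screwMatrix_isHermitian n) hAB hidx.le hz
  ext i
  rw [mulVec_snoc_zero_apply, Pi.zero_apply]
  refine Fin.lastCases ?_ (fun i' => ?_) i
  · simpa [dotProduct] using hb
  · have := congr_fun hz i'
    simpa [mulVec, dotProduct, screwMatrix_apply] using this

/-- Sums against the zero-extension of `z : Fin n → ℝ` to `Fin (n + d)`. [folklore] -/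
theorem sum_mul_zeroExt (n d : ℕ) (z : Fin n → ℝ) (r : ℕ → ℝ) :
    ∑ j : Fin (n + d), r j * (if h : (j : ℕ) < n then z ⟨j, h⟩ else 0) = ∑ j : Fin n, r j * z j := by
  rw [Fin.sum_univ_add]
  simp

/-- Rows of `screwMatrix (n + d)` against the zero-extension of `z`. [folklore] -/
theorem screwMatrix_mulVec_zeroExt (n d : ℕ) (z : Fin n → ℝ) (i : Fin (n + d)) :
    (screwMatrix (n + d) *ᵥ fun j : Fin (n + d) => if h : (j : ℕ) < n then z ⟨j, h⟩ else 0) i =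
      ∑ j : Fin n, zetaScrewKernel (Real.log (((i : ℕ) + 2 : ℕ) : ℝ))
        (Real.log (((j : ℕ) + 2 : ℕ) : ℝ)) * z j := by
  simp only [mulVec, dotProduct, screwMatrix_apply]
  exact sum_mul_zeroExt n d z
    (fun j => zetaScrewKernel (Real.log (((i : ℕ) + 2 : ℕ) : ℝ)) (Real.log ((j + 2 : ℕ) : ℝ)))

/-- **RIGIDITY: under a frozen negative index a null vector of `S_n` kills EVERY later row** —
`Σ_{j<n} G(log(i+2), log(j+2)) z_j = 0` for all `i < n + d`, every `d`. [folklore] -/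
theorem rigid_rows (n : ℕ) (z : Fin n → ℝ) (hz : screwMatrix n *ᵥ z = 0)
    (hfrozen : ∀ d : ℕ,
      (univ.filter fun i => (screwMatrix_isHermitian (n + d + 1)).eigenvalues i < 0).card =
        (univ.filter fun i => (screwMatrix_isHermitian (n + d)).eigenvalues i < 0).card) :
    ∀ d : ℕ, ∀ i : Fin (n + d),
      ∑ j : Fin n, zetaScrewKernel (Real.log (((i : ℕ) + 2 : ℕ) : ℝ))
        (Real.log (((j : ℕ) + 2 : ℕ) : ℝ)) * z j = 0 := by
  intro d
  induction d with
  | zero =>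
    intro i
    have := congr_fun hz i
    simpa [mulVec, dotProduct, screwMatrix_apply] using this
  | succ d ih =>
    have hw : (screwMatrix (n + d) *ᵥ fun j : Fin (n + d) =>
        if h : (j : ℕ) < n then z ⟨j, h⟩ else 0) = 0 := by
      ext i'
      rw [screwMatrix_mulVec_zeroExt, Pi.zero_apply]
      exact ih i'
    have hstep := screw_snoc_mem_ker_of_negIndex_eq (n + d) (hfrozen d) hw
    show ∀ i : Fin (n + d + 1), _
    intro i
    have hi := congr_fun hstep i
    rw [mulVec_snoc_zero_apply, Pi.zero_apply] at hi
    have hred := sum_mul_zeroExt n d z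
      (fun j => zetaScrewKernel (Real.log (((i : ℕ) + 2 : ℕ) : ℝ)) (Real.log ((j + 2 : ℕ) : ℝ)))
    simp only [screwMatrix_apply, Fin.val_castSucc] at hi
    rw [hred] at hi
    exact hi

/-- **FOZ ⟹ eventually nonsingular OR a RIGID NULL COMBINATION**: under finitely many off-line zeros, if
the screw matrices are not eventually nonsingular then ONE fixed finite real combination of kernel
sections `t ↦ Σ_{j<n} z_j G(t, log(j+2))`, `z ≠ 0`, vanishes at EVERY node `t = log(i+2)`, `i ∈ ℕ`
(`foz_negIndex_eventually_const` + `rigid_rows`).  Sharpens g3's `foz_dichotomy` («singular infinitely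
often») to «singular at EVERY level from some point on, witnessed by one rigid vector». [folklore] -/
theorem foz_nonsingular_or_rigidNull (hfoz : CofiniteCriticalLine) :
    (∃ N : ℕ, ∀ n : ℕ, N ≤ n → screwDet n ≠ 0) ∨
      ∃ n : ℕ, ∃ z : Fin n → ℝ, z ≠ 0 ∧ ∀ i : ℕ,
        ∑ j : Fin n, zetaScrewKernel (Real.log ((i + 2 : ℕ) : ℝ))
          (Real.log (((j : ℕ) + 2 : ℕ) : ℝ)) * z j = 0 := by
  obtain ⟨N, k, hNk⟩ := foz_negIndex_eventually_const hfoz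
  by_cases hns : ∃ N' : ℕ, ∀ n : ℕ, N' ≤ n → screwDet n ≠ 0
  · exact Or.inl hns
  · right
    push Not at hns
    obtain ⟨n, hn, hdet⟩ := hns N
    obtain ⟨z, hz0, hz⟩ := Matrix.exists_mulVec_eq_zero_iff.mpr hdet
    refine ⟨n, z, hz0, fun i => ?_⟩
    have hfrozen : ∀ d : ℕ,
        (univ.filter fun i => (screwMatrix_isHermitian (n + d + 1)).eigenvalues i < 0).card =
          (univ.filter fun i => (screwMatrix_isHermitian (n + d)).eigenvalues i < 0).card :=
      fun d => by rw [hNk (n + d + 1) (by omega), hNk (n + d) (by omega)]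
    have := rigid_rows n z hz hfrozen (i + 1) ⟨i, by omega⟩
    simpa using this

/-- **R2 ⟸ NNC**: if no non-zero finite real combination of kernel sections vanishes at every node
(NNC, written out), then FOZ forces eventual nonsingularity of the screw matrices (`FozNonsingular`).
[folklore] -/
theorem fozNonsingular_of_nnc
    (hnnc : ∀ n : ℕ, ∀ z : Fin n → ℝ,
      (∀ i : ℕ, ∑ j : Fin n, zetaScrewKernel (Real.log ((i + 2 : ℕ) : ℝ))
        (Real.log (((j : ℕ) + 2 : ℕ) : ℝ)) * z j = 0) → z = 0) :
    CofiniteCriticalLine → (∃ N : ℕ, ∀ n : ℕ, N ≤ n → screwDet n ≠ 0) := by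
  intro hfoz
  rcases foz_nonsingular_or_rigidNull hfoz with h | ⟨n, z, hz0, hz⟩
  · exact h
  · exact absurd (hnnc n z hz) hz0

/-- **NNC is forced by nonsingularity at infinitely many levels** (a rigid null combination makes EVERY
later screw matrix singular). [folklore] -/
theorem nnc_of_nonsingular_frequently (h : ∀ N : ℕ, ∃ n : ℕ, N ≤ n ∧ screwDet n ≠ 0) :
    ∀ n : ℕ, ∀ z : Fin n → ℝ,
      (∀ i : ℕ, ∑ j : Fin n, zetaScrewKernel (Real.log ((i + 2 : ℕ) : ℝ))
        (Real.log (((j : ℕ) + 2 : ℕ) : ℝ)) * z j = 0) → z = 0 := by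
  intro n z hz
  obtain ⟨m, hm, hdet⟩ := h n
  obtain ⟨d, rfl⟩ := Nat.exists_eq_add_of_le hm
  by_contra hz0
  apply hdet
  apply Matrix.exists_mulVec_eq_zero_iff.mp
  refine ⟨fun j : Fin (n + d) => if h : (j : ℕ) < n then z ⟨j, h⟩ else 0, ?_, ?_⟩
  · intro hzero
    apply hz0
    funext j
    have := congr_fun hzero (Fin.castAdd d j)
    simpa using this
  · ext i
    rw [screwMatrix_mulVec_zeroExt, Pi.zero_apply]
    exact hz i

/-- NNC under RH (every screw matrix is then positive definite). [folklore] -/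
theorem nnc_of_rh (hRH : _root_.RiemannHypothesis) :
    ∀ n : ℕ, ∀ z : Fin n → ℝ,
      (∀ i : ℕ, ∑ j : Fin n, zetaScrewKernel (Real.log ((i + 2 : ℕ) : ℝ))
        (Real.log (((j : ℕ) + 2 : ℕ) : ℝ)) * z j = 0) → z = 0 :=
  nnc_of_nonsingular_frequently fun N =>
    ⟨N, le_rfl, (screwDet_pos_of_posDef (screwMatrix_posDef_of_riemannHypothesis hRH N)).ne'⟩

/-- **Under FOZ, «nonsingular infinitely often» ⟺ «nonsingular eventually».** [folklore] -/
theorem foz_nonsingular_eventually_iff_frequently (hfoz : CofiniteCriticalLine) :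
    (∃ N : ℕ, ∀ n : ℕ, N ≤ n → screwDet n ≠ 0) ↔ (∀ N : ℕ, ∃ n : ℕ, N ≤ n ∧ screwDet n ≠ 0) := by
  constructor
  · rintro ⟨N, hN⟩ N'
    exact ⟨max N N', le_max_right _ _, hN _ (le_max_left _ _)⟩
  · intro h
    exact fozNonsingular_of_nnc (nnc_of_nonsingular_frequently h) hfoz

/-- **The bridge `FOZ ⟹ ETAIL` is exactly `FOZ ⟹ NNC`** (R2 = the null-combination residual):
`inertiaOfFoz_iff_fozNonsingular` + rigidity. [folklore] -/
theorem inertiaOfFoz_iff_foz_imp_nnc :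
    (CofiniteCriticalLine → (∃ M₀ : ℕ, ∀ M : ℕ, M₀ ≤ M → 0 < screwPivot M)) ↔
      (CofiniteCriticalLine → ∀ n : ℕ, ∀ z : Fin n → ℝ,
        (∀ i : ℕ, ∑ j : Fin n, zetaScrewKernel (Real.log ((i + 2 : ℕ) : ℝ))
          (Real.log (((j : ℕ) + 2 : ℕ) : ℝ)) * z j = 0) → z = 0) := by
  rw [inertiaOfFoz_iff_fozNonsingular]
  constructor
  · intro h hfoz
    obtain ⟨N, hN⟩ := h hfoz
    exact nnc_of_nonsingular_frequently fun N' => ⟨max N N', le_max_right _ _, hN _ (le_max_left _ _)⟩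
  · intro h hfoz
    exact fozNonsingular_of_nnc (h hfoz) hfoz

/-- `ETAIL ⟺ FOZ` modulo R3 (`IndexTransfer`) and NNC. [folklore] -/
theorem etail_iff_foz_of_indexTransfer_nnc
    (hT : (∃ K : ℕ, ∀ n : ℕ,
      (Finset.univ.filter fun i => (screwMatrix_isHermitian n).eigenvalues i < 0).card ≤ K) →
        CofiniteCriticalLine)
    (hnnc : ∀ n : ℕ, ∀ z : Fin n → ℝ,
      (∀ i : ℕ, ∑ j : Fin n, zetaScrewKernel (Real.log ((i + 2 : ℕ) : ℝ))
        (Real.log (((j : ℕ) + 2 : ℕ) : ℝ)) * z j = 0) → z = 0) :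
    (∃ M₀ : ℕ, ∀ M : ℕ, M₀ ≤ M → 0 < screwPivot M) ↔ CofiniteCriticalLine :=
  etail_iff_foz_of hT (fozNonsingular_of_nnc hnnc)

end Rigidity

end Summit.RiemannHypothesis.RiemannHypothesis.Theorems.Splittings.ScrewBridgeRigidity

end
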